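import Mathlib
import Literature.Probability.LatticeModels.LatticeGraph
import HarnessLib

/-!
# Crux `SelfNormalisedSkewness` (stmt-QuantumFields-18944), line `Sketch`, stub `stub_torusLatticeSums`:
# lattice sums on the discrete four-torus

For the discrete torus `(ℤ/S)⁴` with centred coordinates `valMinAbs ∈ (-S/2, S/2]` and the
Euclidean torus distance `dist w = √(∑_μ valMinAbs (w μ)²)` we prove, with ONE absolute constant
`C = 1250` for all `S ≥ 1`:

* `∑_{w ≠ 0} dist⁻⁴ ≤ C (1 + log S)`;
* `∑_{w ≠ 0} dist⁻⁵ ≤ C`;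
* `∑_{dist ≥ r} dist⁻⁸ ≤ C r⁻⁴` for `r ≥ 1`;
* `#{w : dist (w - w₀) < r} ≤ (2r+1)⁴` for `r ≥ 0`.

The ball count is the injection `w ↦ (valMinAbs ((w - w₀) μ))_μ` into the integer box
`[-⌊r⌋, ⌊r⌋]⁴`; the three sums follow from an abstract dyadic-shell bound
(`sum_inv_pow_le_dyadic`: decompose into the shells `2ʲ r ≤ dist < 2ʲ⁺¹ r`, each of which has
at most `(5 · 2ʲ r)⁴` points). Everything here is folklore lattice bookkeeping.
-/

noncomputable section

open scoped BigOperators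
open Literature.Probability.LatticeModels (TorusSite)

namespace Summit.QuantumFields.YangMills.Theorems.SelfNormalisedSkewness.Negative

/-! ### An abstract dyadic-shell bound -/

/-- **Dyadic shell bound.** If `r ≤ N < 2ᴷ r` on a finite set `T` (with `r ≥ 1`) and the balls
`{N < t}` in `T` have at most `(2t+1)⁴` points, then
`∑_{T} N⁻⁽ᵖ⁺⁴⁾ ≤ ∑_{j<K} 625 (2ʲ r)⁻ᵖ` (decompose `T` into the dyadic shells
`2ʲ r ≤ N < 2ʲ⁺¹ r`, `j < K`, each of cardinality `≤ (2·2ʲ⁺¹ r + 1)⁴ ≤ (5 · 2ʲ r)⁴`). [folklore] -/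
theorem sum_inv_pow_le_dyadic {α : Type*} (T : Finset α) (N : α → ℝ) (p K : ℕ) {r : ℝ}
    (hr : 1 ≤ r) (hlow : ∀ w ∈ T, r ≤ N w) (hup : ∀ w ∈ T, N w < 2 ^ K * r)
    (hcount : ∀ t : ℝ, 0 ≤ t → ((T.filter (fun w => N w < t)).card : ℝ) ≤ (2 * t + 1) ^ 4) :
    ∑ w ∈ T, (N w)⁻¹ ^ (p + 4) ≤ ∑ j ∈ Finset.range K, 625 * (2 ^ j * r)⁻¹ ^ p := by
  have hr0 : 0 < r := one_pos.trans_le hr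
  -- the dyadic shell index: `g w = j ↔ 2ʲ r ≤ N w < 2ʲ⁺¹ r`
  set g : α → ℕ := fun w => Nat.log 2 ⌊N w / r⌋₊ with hg
  have hshell : ∀ w ∈ T, 2 ^ g w * r ≤ N w ∧ N w < 2 ^ (g w + 1) * r := by
    intro w hw
    have hq0 : 0 ≤ N w / r := div_nonneg (zero_le_one.trans (hr.trans (hlow w hw))) hr0.le
    have h1 : 1 ≤ N w / r := by rw [le_div_iff₀ hr0, one_mul]; exact hlow w hw
    have hfl : ⌊N w / r⌋₊ ≠ 0 := (Nat.floor_pos.2 h1).ne'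
    refine ⟨?_, ?_⟩
    · have h2 : 2 ^ g w ≤ ⌊N w / r⌋₊ := Nat.pow_log_le_self 2 hfl
      have h3 : (2 : ℝ) ^ g w ≤ N w / r := by
        calc (2 : ℝ) ^ g w = ((2 ^ g w : ℕ) : ℝ) := by norm_num
          _ ≤ (⌊N w / r⌋₊ : ℝ) := by exact_mod_cast h2
          _ ≤ N w / r := Nat.floor_le hq0
      rwa [le_div_iff₀ hr0] at h3
    · have h2 : ⌊N w / r⌋₊ + 1 ≤ 2 ^ (g w + 1) := Nat.lt_pow_succ_log_self one_lt_two _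
      have h3 : N w / r < (2 : ℝ) ^ (g w + 1) := by
        calc N w / r < (⌊N w / r⌋₊ : ℝ) + 1 := Nat.lt_floor_add_one _
          _ = ((⌊N w / r⌋₊ + 1 : ℕ) : ℝ) := by norm_num
          _ ≤ ((2 ^ (g w + 1) : ℕ) : ℝ) := by exact_mod_cast h2
          _ = (2 : ℝ) ^ (g w + 1) := by norm_num
      rwa [div_lt_iff₀ hr0] at h3
  have hmaps : ∀ w ∈ T, g w ∈ Finset.range K := by
    intro w hw
    rw [Finset.mem_range]
    have h := (hshell w hw).1.trans_lt (hup w hw)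
    have h' : (2 : ℝ) ^ g w < 2 ^ K := lt_of_mul_lt_mul_right h hr0.le
    exact (pow_lt_pow_iff_right₀ one_lt_two).1 h'
  rw [← Finset.sum_fiberwise_of_maps_to hmaps (fun w => (N w)⁻¹ ^ (p + 4))]
  refine Finset.sum_le_sum fun j _ => ?_
  have hj0 : 0 < (2 : ℝ) ^ j * r := by positivity
  have hj1 : 1 ≤ (2 : ℝ) ^ j * r := by
    calc (1 : ℝ) = 1 * 1 := (mul_one 1).symm
      _ ≤ 2 ^ j * r := mul_le_mul (one_le_pow₀ one_le_two) hr zero_le_one (by positivity)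
  have hsub : T.filter (fun w => g w = j) ⊆ T.filter (fun w => N w < 2 ^ (j + 1) * r) := by
    intro w hw
    rw [Finset.mem_filter] at hw ⊢
    have h := (hshell w hw.1).2
    rw [hw.2] at h
    exact ⟨hw.1, h⟩
  have hx4 : ((2 : ℝ) ^ j * r) ^ 4 * ((2 : ℝ) ^ j * r)⁻¹ ^ 4 = 1 := by
    rw [← mul_pow, mul_inv_cancel₀ hj0.ne', one_pow]
  calc ∑ w ∈ T with g w = j, (N w)⁻¹ ^ (p + 4)
      ≤ ∑ w ∈ T with g w = j, ((2 : ℝ) ^ j * r)⁻¹ ^ (p + 4) := by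
        refine Finset.sum_le_sum fun w hw => ?_
        rw [Finset.mem_filter] at hw
        have hle : 2 ^ j * r ≤ N w := by
          have h := (hshell w hw.1).1
          rwa [hw.2] at h
        exact pow_le_pow_left₀ (inv_nonneg.2 (hj0.trans_le hle).le) (inv_anti₀ hj0 hle) _
    _ = ((T.filter (fun w => g w = j)).card : ℝ) * ((2 : ℝ) ^ j * r)⁻¹ ^ (p + 4) := by
        rw [Finset.sum_const, nsmul_eq_mul]
    _ ≤ ((T.filter (fun w => N w < 2 ^ (j + 1) * r)).card : ℝ) * ((2 : ℝ) ^ j * r)⁻¹ ^ (p + 4) := by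
        refine mul_le_mul_of_nonneg_right ?_ (pow_nonneg (inv_nonneg.2 hj0.le) _)
        exact_mod_cast Finset.card_le_card hsub
    _ ≤ (2 * (2 ^ (j + 1) * r) + 1) ^ 4 * ((2 : ℝ) ^ j * r)⁻¹ ^ (p + 4) :=
        mul_le_mul_of_nonneg_right (hcount _ (mul_nonneg (pow_nonneg zero_le_two _) hr0.le))
          (pow_nonneg (inv_nonneg.2 hj0.le) _)
    _ ≤ (5 * (2 ^ j * r)) ^ 4 * ((2 : ℝ) ^ j * r)⁻¹ ^ (p + 4) := by
        refine mul_le_mul_of_nonneg_right ?_ (pow_nonneg (inv_nonneg.2 hj0.le) _)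
        refine pow_le_pow_left₀ (by positivity) ?_ 4
        rw [pow_succ]
        linarith
    _ = 625 * (((2 : ℝ) ^ j * r) ^ 4 * ((2 : ℝ) ^ j * r)⁻¹ ^ 4) * ((2 : ℝ) ^ j * r)⁻¹ ^ p := by
        ring
    _ = 625 * ((2 : ℝ) ^ j * r)⁻¹ ^ p := by rw [hx4, mul_one]

/-- `∑_{j<K} 2⁻ʲ ≤ 2`. [folklore] -/
theorem sum_range_inv_two_pow_le (K : ℕ) : ∑ j ∈ Finset.range K, ((2 : ℝ) ^ j)⁻¹ ≤ 2 := by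
  have h := geom_sum_Ico_le_of_lt_one (x := (2 : ℝ)⁻¹) (m := 0) (n := K) (by norm_num) (by norm_num)
  rw [← Finset.range_eq_Ico] at h
  calc ∑ j ∈ Finset.range K, ((2 : ℝ) ^ j)⁻¹ = ∑ j ∈ Finset.range K, (2 : ℝ)⁻¹ ^ j := by
        simp [inv_pow]
    _ ≤ (2 : ℝ)⁻¹ ^ 0 / (1 - 2⁻¹) := h
    _ = 2 := by norm_num

/-- `Nat.log 2 S ≤ 2 log S` for `S ≥ 1`. [folklore] -/
theorem natLog_two_le_two_mul_log (S : ℕ) [NeZero S] : (Nat.log 2 S : ℝ) ≤ 2 * Real.log S := by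
  have h1 : 2 ^ Nat.log 2 S ≤ S := Nat.pow_log_le_self 2 (NeZero.ne S)
  have h2 : (2 : ℝ) ^ Nat.log 2 S ≤ S := by exact_mod_cast h1
  have h3 : Real.log ((2 : ℝ) ^ Nat.log 2 S) ≤ Real.log S := Real.log_le_log (by positivity) h2
  rw [Real.log_pow] at h3
  have h4 := Real.log_two_gt_d9
  have h5 : (0 : ℝ) ≤ Nat.log 2 S := Nat.cast_nonneg _
  nlinarith

/-! ### Torus geometry in centred coordinates -/

/-- A coordinate is bounded by the Euclidean norm: `|v μ| ≤ √(∑_ν (v ν)²)`. [folklore] -/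
theorem abs_coord_le_sqrt_sum_sq (v : Fin 4 → ℤ) (μ : Fin 4) :
    |((v μ : ℤ) : ℝ)| ≤ Real.sqrt (∑ ν, ((v ν : ℤ) : ℝ) ^ 2) :=
  Real.abs_le_sqrt (Finset.single_le_sum (f := fun ν => ((v ν : ℤ) : ℝ) ^ 2)
    (fun _ _ => sq_nonneg _) (Finset.mem_univ μ))

/-- **Ball count** on the discrete four-torus: `#{w : dist (w - w₀) < r} ≤ (2r+1)⁴` for `r ≥ 0`;
the centred coordinates inject the ball into the integer box `[-⌊r⌋, ⌊r⌋]⁴`. [folklore] -/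
theorem card_torusBall_le {S : ℕ} [NeZero S] (r : ℝ) (hr : 0 ≤ r) (w₀ : TorusSite 4 S) :
    (((Finset.univ : Finset (TorusSite 4 S)).filter
        (fun w => Real.sqrt (∑ μ, ((((w - w₀) μ).valMinAbs : ℤ) : ℝ) ^ 2) < r)).card : ℝ) ≤
      (2 * r + 1) ^ 4 := by
  have hM0 : 0 ≤ ⌊r⌋ := Int.floor_nonneg.2 hr
  have hMr : ((⌊r⌋ : ℤ) : ℝ) ≤ r := Int.floor_le r
  -- the integer box and its cardinality
  have hBcard : ((Fintype.piFinset fun _ : Fin 4 => Finset.Icc (-⌊r⌋) ⌊r⌋).card : ℝ) =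
      (2 * ((⌊r⌋ : ℤ) : ℝ) + 1) ^ 4 := by
    have h1 : (Fintype.piFinset fun _ : Fin 4 => Finset.Icc (-⌊r⌋) ⌊r⌋).card =
        ((⌊r⌋ + 1 - -⌊r⌋).toNat) ^ 4 := by
      rw [Fintype.card_piFinset, Finset.prod_const, Finset.card_univ, Fintype.card_fin,
        Int.card_Icc]
    have h2 : (((⌊r⌋ + 1 - -⌊r⌋).toNat : ℕ) : ℤ) = 2 * ⌊r⌋ + 1 := by
      rw [Int.toNat_of_nonneg (by omega)]; ring
    have h3 : (((⌊r⌋ + 1 - -⌊r⌋).toNat : ℕ) : ℝ) = 2 * ((⌊r⌋ : ℤ) : ℝ) + 1 := by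
      have h4 : (((⌊r⌋ + 1 - -⌊r⌋).toNat : ℕ) : ℝ) = ((((⌊r⌋ + 1 - -⌊r⌋).toNat : ℕ) : ℤ) : ℝ) :=
        (Int.cast_natCast _).symm
      rw [h4, h2]; push_cast; ring
    rw [h1]; push_cast; rw [h3]
  -- the centred coordinates map the ball into the box
  have hmaps : Set.MapsTo (fun (w : TorusSite 4 S) (μ : Fin 4) => ((w - w₀) μ).valMinAbs)
      ↑((Finset.univ : Finset (TorusSite 4 S)).filter
        (fun w => Real.sqrt (∑ μ, ((((w - w₀) μ).valMinAbs : ℤ) : ℝ) ^ 2) < r))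
      ↑(Fintype.piFinset fun _ : Fin 4 => Finset.Icc (-⌊r⌋) ⌊r⌋) := by
    intro w hw
    rw [Finset.coe_filter, Set.mem_setOf_eq] at hw
    rw [Finset.mem_coe, Fintype.mem_piFinset]
    intro μ
    rw [Finset.mem_Icc]
    have habs : |((((w - w₀) μ).valMinAbs : ℤ) : ℝ)| < r :=
      (abs_coord_le_sqrt_sum_sq (fun ν => ((w - w₀) ν).valMinAbs) μ).trans_lt hw.2
    rw [abs_lt] at habs
    have hneg : -((w - w₀) μ).valMinAbs ≤ ⌊r⌋ := Int.le_floor.2 (by push_cast; linarith [habs.1])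
    exact ⟨neg_le.1 hneg, Int.le_floor.2 habs.2.le⟩
  -- and injectively so
  have hinj : Set.InjOn (fun (w : TorusSite 4 S) (μ : Fin 4) => ((w - w₀) μ).valMinAbs)
      ↑((Finset.univ : Finset (TorusSite 4 S)).filter
        (fun w => Real.sqrt (∑ μ, ((((w - w₀) μ).valMinAbs : ℤ) : ℝ) ^ 2) < r)) := by
    intro w _ w' _ h
    have h' : w - w₀ = w' - w₀ := funext fun μ => ZMod.valMinAbs_inj.1 (congr_fun h μ)
    exact sub_left_inj.1 h'
  calc (((Finset.univ : Finset (TorusSite 4 S)).filter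
        (fun w => Real.sqrt (∑ μ, ((((w - w₀) μ).valMinAbs : ℤ) : ℝ) ^ 2) < r)).card : ℝ)
      ≤ ((Fintype.piFinset fun _ : Fin 4 => Finset.Icc (-⌊r⌋) ⌊r⌋).card : ℝ) := by
        exact_mod_cast Finset.card_le_card_of_injOn _ hmaps hinj
    _ = (2 * ((⌊r⌋ : ℤ) : ℝ) + 1) ^ 4 := hBcard
    _ ≤ (2 * r + 1) ^ 4 := by
        have h0 : (0 : ℝ) ≤ ((⌊r⌋ : ℤ) : ℝ) := by exact_mod_cast hM0
        exact pow_le_pow_left₀ (by linarith) (by linarith) 4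

/-- A nonzero site of the discrete torus has distance `≥ 1` from the origin (some centred
coordinate is a nonzero integer). [folklore] -/
theorem one_le_torusDist {S : ℕ} {w : TorusSite 4 S} (hw : w ≠ 0) :
    1 ≤ Real.sqrt (∑ μ, (((w μ).valMinAbs : ℤ) : ℝ) ^ 2) := by
  obtain ⟨μ, hμ⟩ : ∃ μ, w μ ≠ 0 := by
    by_contra h
    push Not at h
    exact hw (funext h)
  have h1 : (w μ).valMinAbs ≠ 0 := fun h => hμ ((ZMod.valMinAbs_eq_zero _).1 h)
  have h2 : (1 : ℝ) ≤ (((w μ).valMinAbs : ℤ) : ℝ) ^ 2 := by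
    have h3 : (1 : ℤ) ≤ ((w μ).valMinAbs) ^ 2 := (one_le_sq_iff_one_le_abs _).2 (Int.one_le_abs h1)
    exact_mod_cast h3
  rw [Real.one_le_sqrt]
  exact h2.trans (Finset.single_le_sum (f := fun ν => (((w ν).valMinAbs : ℤ) : ℝ) ^ 2)
    (fun _ _ => sq_nonneg _) (Finset.mem_univ μ))

/-- The torus distance is `≤ 2S < 2 ^ (Nat.log 2 S + 2)` (each centred coordinate is at most
`S/2 ≤ S` in absolute value). [folklore] -/
theorem torusDist_lt_two_pow {S : ℕ} [NeZero S] (w : TorusSite 4 S) :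
    Real.sqrt (∑ μ, (((w μ).valMinAbs : ℤ) : ℝ) ^ 2) < 2 ^ (Nat.log 2 S + 2) := by
  have hco : ∀ μ, (((w μ).valMinAbs : ℤ) : ℝ) ^ 2 ≤ (S : ℝ) ^ 2 := by
    intro μ
    have h1 : ((w μ).valMinAbs).natAbs ≤ S :=
      (ZMod.natAbs_valMinAbs_le (w μ)).trans (Nat.div_le_self S 2)
    have h2 : |(((w μ).valMinAbs : ℤ) : ℝ)| ≤ S := by
      rw [← Int.cast_abs, Int.abs_eq_natAbs]
      exact_mod_cast h1
    calc (((w μ).valMinAbs : ℤ) : ℝ) ^ 2 = |(((w μ).valMinAbs : ℤ) : ℝ)| ^ 2 := (sq_abs _).symm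
      _ ≤ (S : ℝ) ^ 2 := pow_le_pow_left₀ (abs_nonneg _) h2 2
  have hsum : ∑ μ, (((w μ).valMinAbs : ℤ) : ℝ) ^ 2 ≤ (2 * S) ^ 2 := by
    calc ∑ μ, (((w μ).valMinAbs : ℤ) : ℝ) ^ 2 ≤ ∑ _μ : Fin 4, (S : ℝ) ^ 2 :=
          Finset.sum_le_sum fun μ _ => hco μ
      _ = (2 * S) ^ 2 := by simp; ring
  have hS : S < 2 ^ (Nat.log 2 S + 1) := Nat.lt_pow_succ_log_self one_lt_two S
  have hS' : (2 : ℝ) * S < 2 ^ (Nat.log 2 S + 2) := by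
    have h : (S : ℝ) < 2 ^ (Nat.log 2 S + 1) := by exact_mod_cast hS
    rw [pow_succ]
    linarith
  calc Real.sqrt (∑ μ, (((w μ).valMinAbs : ℤ) : ℝ) ^ 2) ≤ Real.sqrt ((2 * S) ^ 2) :=
        Real.sqrt_le_sqrt hsum
    _ = 2 * S := Real.sqrt_sq (by positivity)
    _ < 2 ^ (Nat.log 2 S + 2) := hS'

/-! ### The stub -/

/-- Wave-2 stub S-a: torus lattice sums in four dimensions. With `dist w = √(∑_μ valMinAbs(w μ)²)`
on `(ℤ/S)⁴` and the absolute constant `C = 1250`: `∑_{w≠0} dist⁻⁴ ≤ C (1 + log S)`,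
`∑_{w≠0} dist⁻⁵ ≤ C`, `∑_{dist ≥ r} dist⁻⁸ ≤ C r⁻⁴` (`r ≥ 1`), and the ball count
`#{w : dist (w - w₀) < r} ≤ (2r+1)⁴` (`r ≥ 0`). [folklore] -/
theorem stub_torusLatticeSums : ∃ C : ℝ, ∀ (S : ℕ) [NeZero S],
    (∑ w ∈ (Finset.univ : Finset (TorusSite 4 S)).erase 0,
        (Real.sqrt (∑ μ, (((w μ).valMinAbs : ℤ) : ℝ) ^ 2))⁻¹ ^ 4 ≤ C * (1 + Real.log S)) ∧
    (∑ w ∈ (Finset.univ : Finset (TorusSite 4 S)).erase 0,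
        (Real.sqrt (∑ μ, (((w μ).valMinAbs : ℤ) : ℝ) ^ 2))⁻¹ ^ 5 ≤ C) ∧
    (∀ r : ℝ, 1 ≤ r →
      ∑ w ∈ (Finset.univ : Finset (TorusSite 4 S)).filter
          (fun w => r ≤ Real.sqrt (∑ μ, (((w μ).valMinAbs : ℤ) : ℝ) ^ 2)),
        (Real.sqrt (∑ μ, (((w μ).valMinAbs : ℤ) : ℝ) ^ 2))⁻¹ ^ 8 ≤ C * r⁻¹ ^ 4) ∧
    (∀ r : ℝ, 0 ≤ r → ∀ w₀ : TorusSite 4 S,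
      (((Finset.univ : Finset (TorusSite 4 S)).filter
          (fun w => Real.sqrt (∑ μ, ((((w - w₀) μ).valMinAbs : ℤ) : ℝ) ^ 2) < r)).card : ℝ) ≤ (2 * r + 1) ^ 4) := by
  refine ⟨1250, fun S _ => ?_⟩
  -- ball counts inside arbitrary finite sets of sites
  have hcnt : ∀ (T : Finset (TorusSite 4 S)) (t : ℝ), 0 ≤ t →
      ((T.filter (fun w => Real.sqrt (∑ μ, (((w μ).valMinAbs : ℤ) : ℝ) ^ 2) < t)).card : ℝ) ≤
        (2 * t + 1) ^ 4 := by
    intro T t ht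
    have h := card_torusBall_le t ht (0 : TorusSite 4 S)
    simp only [sub_zero] at h
    refine le_trans ?_ h
    exact_mod_cast Finset.card_le_card (Finset.filter_subset_filter _ (Finset.subset_univ T))
  have hlow : ∀ w ∈ (Finset.univ : Finset (TorusSite 4 S)).erase 0,
      (1 : ℝ) ≤ Real.sqrt (∑ μ, (((w μ).valMinAbs : ℤ) : ℝ) ^ 2) :=
    fun w hw => one_le_torusDist (Finset.ne_of_mem_erase hw)
  have hup : ∀ w ∈ (Finset.univ : Finset (TorusSite 4 S)).erase 0,
      Real.sqrt (∑ μ, (((w μ).valMinAbs : ℤ) : ℝ) ^ 2) < 2 ^ (Nat.log 2 S + 2) * 1 :=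
    fun w _ => by rw [mul_one]; exact torusDist_lt_two_pow w
  have hlogS : 0 ≤ Real.log S := Real.log_nonneg (by exact_mod_cast Nat.one_le_iff_ne_zero.2 (NeZero.ne S))
  have hlog := natLog_two_le_two_mul_log S
  have hgeom := sum_range_inv_two_pow_le (Nat.log 2 S + 2)
  refine ⟨?_, ?_, ?_, fun r hr w₀ => card_torusBall_le r hr w₀⟩
  · -- `∑ dist⁻⁴ ≤ 625 (Nat.log 2 S + 2) ≤ 1250 (1 + log S)`
    have h := sum_inv_pow_le_dyadic _
      (fun w : TorusSite 4 S => Real.sqrt (∑ μ, (((w μ).valMinAbs : ℤ) : ℝ) ^ 2))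
      0 (Nat.log 2 S + 2) le_rfl hlow hup (hcnt _)
    refine h.trans ?_
    simp only [pow_zero, mul_one, Finset.sum_const, Finset.card_range, nsmul_eq_mul]
    push_cast
    nlinarith
  · -- `∑ dist⁻⁵ ≤ 625 ∑ 2⁻ʲ ≤ 1250`
    have h := sum_inv_pow_le_dyadic _
      (fun w : TorusSite 4 S => Real.sqrt (∑ μ, (((w μ).valMinAbs : ℤ) : ℝ) ^ 2))
      1 (Nat.log 2 S + 2) le_rfl hlow hup (hcnt _)
    refine h.trans ?_
    rw [← Finset.mul_sum]
    simp only [pow_one, mul_one]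
    nlinarith
  · -- `∑_{dist ≥ r} dist⁻⁸ ≤ 625 r⁻⁴ ∑ 2⁻ʲ ≤ 1250 r⁻⁴`
    intro r hr
    have hr0 : 0 < r := one_pos.trans_le hr
    have hlow' : ∀ w ∈ (Finset.univ : Finset (TorusSite 4 S)).filter
        (fun w => r ≤ Real.sqrt (∑ μ, (((w μ).valMinAbs : ℤ) : ℝ) ^ 2)),
        r ≤ Real.sqrt (∑ μ, (((w μ).valMinAbs : ℤ) : ℝ) ^ 2) :=
      fun w hw => (Finset.mem_filter.1 hw).2
    have hup' : ∀ w ∈ (Finset.univ : Finset (TorusSite 4 S)).filter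
        (fun w => r ≤ Real.sqrt (∑ μ, (((w μ).valMinAbs : ℤ) : ℝ) ^ 2)),
        Real.sqrt (∑ μ, (((w μ).valMinAbs : ℤ) : ℝ) ^ 2) < 2 ^ (Nat.log 2 S + 2) * r :=
      fun w _ => (torusDist_lt_two_pow w).trans_le (le_mul_of_one_le_right (by positivity) hr)
    have h := sum_inv_pow_le_dyadic _
      (fun w : TorusSite 4 S => Real.sqrt (∑ μ, (((w μ).valMinAbs : ℤ) : ℝ) ^ 2))
      4 (Nat.log 2 S + 2) hr hlow' hup' (hcnt _)
    refine h.trans ?_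
    have h4 : 0 ≤ r⁻¹ ^ 4 := pow_nonneg (inv_nonneg.2 hr0.le) 4
    have hterm : ∀ j ∈ Finset.range (Nat.log 2 S + 2),
        (625 : ℝ) * (2 ^ j * r)⁻¹ ^ 4 ≤ 625 * r⁻¹ ^ 4 * ((2 : ℝ) ^ j)⁻¹ := by
      intro j _
      have h2 : (1 : ℝ) ≤ 2 ^ j := one_le_pow₀ one_le_two
      have h3 : ((2 : ℝ) ^ j)⁻¹ ^ 4 ≤ ((2 : ℝ) ^ j)⁻¹ :=
        pow_le_of_le_one (by positivity) (inv_le_one_of_one_le₀ h2) four_ne_zero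
      rw [mul_inv, mul_pow]
      nlinarith
    refine (Finset.sum_le_sum hterm).trans ?_
    rw [← Finset.mul_sum]
    nlinarith

end Summit.QuantumFields.YangMills.Theorems.SelfNormalisedSkewness.Negative
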